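import Literature.Geometry.Lorentzian.SpacetimeLocalConvergenceTimeOrientation
import HarnessLib

/-!
# Pushed charts keep their time orientation along a pointed `Cᵏ_loc` convergence
(topic `Geometry/Lorentzian`; the orientation clause of "push a chart of the limit through the
comparison maps" — companion of `SpacetimeLocalConvergenceChartTransport.lean`; Petersen 2006,
Ch. 10, §3.2; O'Neill 1983, Ch. 5, p. 145)

Let `D : (𝓢ₙ, pₙ) ⇀ (𝓣, t)` be a subconvergence datum with comparison maps `φₙ`, `Ψ : E4 → 𝓣` a map
`C^∞` on an open set `O ⊆ E4` (a chart map / window chart read through its representative), `K ⊆ O`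
compact and `V : E4` a coordinate vector (e.g. `∂_{t*} = e₀`). If `dΨ_x(V)` is future-directed and
TIMELIKE for every `x ∈ K`, then for all large `n` the pushed charts `φₙ ∘ Ψ` send `V` at every
`x ∈ K` to a future-directed vector of `𝓢ₙ`
(`LocalSubconvergence.eventually_isFutureDirected_mfderiv_comp_chart`). Timelikeness (not mere
causality) of `dΨ(V)` on `K` is what makes the margin argument work; it is necessary — a null image
can be tipped spacelike by every `φₙ`.

Mechanism: as for `eventually_isFutureDirected_mfderiv_comp` (orienting field of a source
spacetime), with the simpler coordinate image `d(c' ∘ Ψ)_x(V) = D(c' ∘ Ψ)(x) V` of the pushed vector.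

Supplying the hypothesis: `Spacetime.isFutureDirected_mfderiv_of_isPreconnected` — on a
PRECONNECTED `S ⊆ O` a causal family `dΨ_x(V)` that is future-directed at one point is
future-directed everywhere (a causal vector is never orthogonal to the orienting field, O'Neill 1983,
Ch. 5, Lemma 5.26 ff., so the continuous sign `g(T, dΨ_x V)` cannot change on `S`); combined:
`LocalSubconvergence.eventually_isFutureDirected_mfderiv_comp_chart_of_isPreconnected` (timelike on
a compact preconnected `K`, future-directed at one point ⇒ pushed charts future-directed on `K`).

## References
* [Petersen2006] P. Petersen, *Riemannian Geometry*, 2nd ed., GTM 171, Springer 2006, Ch. 10, §3.2.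
* [ONeill1983] B. O'Neill, *Semi-Riemannian Geometry*, Academic Press 1983, Ch. 5, p. 145.
-/

noncomputable section

open TopologicalSpace Manifold Filter Topology Set Function Metric Bundle
open scoped ContDiff Topology ENNReal

universe u v

namespace Literature.Geometry.Lorentzian

namespace Spacetime

variable {𝓢ₙ : ℕ → Spacetime.{u} 4} {pₙ : ∀ n, (𝓢ₙ n).carrier} {𝓣 : Spacetime.{v} 4}
  {t : 𝓣.carrier} {k : ℕ}

namespace LocalSubconvergence

/-- **Pushed charts keep their orientation, on one chart piece of the target.** [cite: ONeill1983, Ch. 5, p. 145] -/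
theorem eventually_isFutureDirected_mfderiv_comp_chart_of_piece (D : LocalSubconvergence 𝓢ₙ pₙ 𝓣 t k)
    {Ψ : E4 → 𝓣.carrier} {O : Set E4} (hO : IsOpen O) (hΨ : ContMDiffOn 𝓘(ℝ, E4) (𝓡 4) ∞ Ψ O)
    (x₀ : 𝓣.carrier) {N : Set E4} (hN : IsCompact N) (hNO : N ⊆ O ∩ Ψ ⁻¹' (chartAt E4 x₀).source)
    (V : E4)
    (hfut : ∀ x ∈ N, 𝓣.timeOrientation.IsFutureDirected (mfderiv 𝓘(ℝ, E4) (𝓡 4) Ψ x V))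
    (htl : ∀ x ∈ N, 𝓣.metric.IsTimelike (mfderiv 𝓘(ℝ, E4) (𝓡 4) Ψ x V)) :
    ∀ᶠ n in atTop, ∀ x ∈ N, (𝓢ₙ (D.sub n)).timeOrientation.IsFutureDirected
      (mfderiv 𝓘(ℝ, E4) (𝓡 4) (D.embed n ∘ Ψ) x V) := by
  set c := chartAt E4 x₀ with hc
  set O' : Set E4 := O ∩ Ψ ⁻¹' c.source with hO'
  have hO'o : IsOpen O' := hΨ.continuousOn.isOpen_inter_preimage hO c.open_source
  -- the coordinate quantities
  let θ : E4 → E4 := c ∘ Ψ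
  let Vc : E4 → E4 := fun x ↦ fderiv ℝ θ x V
  let W : E4 → E4 := fun x ↦ 𝓣.timeOrientation.chartTime x₀ (Ψ x)
  let m : E4 → E4 →L[ℝ] E4 →L[ℝ] ℝ := fun x ↦ 𝓣.metricInCoords c.symm (c (Ψ x))
  let α : E4 → ℝ := fun x ↦ m x (Vc x) (Vc x)
  let β : E4 → ℝ := fun x ↦ m x (W x) (Vc x)
  let γ : E4 → ℝ := fun x ↦ m x (W x) (W x)
  have hθs : ContDiffOn ℝ ∞ θ O' := by
    rw [← contMDiffOn_iff_contDiffOn]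
    exact (contMDiffOn_chart (x := x₀)).comp (hΨ.mono inter_subset_left) fun x hx ↦ hx.2
  have hVcc : ContinuousOn Vc N :=
    ((hθs.continuousOn_fderiv_of_isOpen hO'o (by exact_mod_cast le_top)).clm_apply
      continuousOn_const).mono hNO
  have hWc : ContinuousOn W N :=
    ((𝓣.timeOrientation.contMDiffOn_chartTime (by exact_mod_cast le_top) x₀).continuousOn.comp
      (hΨ.continuousOn.mono inter_subset_left) (fun _ hx ↦ hx.2)).mono hNO
  have hmc : ContinuousOn m N :=
    ((𝓣.contDiffOn_metricInCoords_chartAt_symm x₀).continuousOn.comp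
      (c.continuousOn.comp (hΨ.continuousOn.mono inter_subset_left) fun _ hx ↦ hx.2)
      (fun _ hx ↦ c.map_source hx.2)).mono hNO
  have hαc : ContinuousOn α N := (hmc.clm_apply hVcc).clm_apply hVcc
  have hβc : ContinuousOn β N := (hmc.clm_apply hWc).clm_apply hVcc
  have hγc : ContinuousOn γ N := (hmc.clm_apply hWc).clm_apply hWc
  -- identities at a point of `N`
  have hΨd : ∀ x ∈ N, MDifferentiableAt 𝓘(ℝ, E4) (𝓡 4) Ψ x := fun x hx ↦
    ((hΨ x (hNO hx).1).contMDiffAt (hO.mem_nhds (hNO hx).1)).mdifferentiableAt (by simp)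
  have hz : ∀ x ∈ N, Ψ x ∈ c.source := fun x hx ↦ (hNO hx).2
  have hVcx : ∀ x ∈ N, Vc x = mfderiv (𝓡 4) 𝓘(ℝ, E4) c (Ψ x) (mfderiv 𝓘(ℝ, E4) (𝓡 4) Ψ x V) := by
    intro x hx
    show fderiv ℝ (c ∘ Ψ) x V = _
    rw [← mfderiv_eq_fderiv, mfderiv_comp x ((mdifferentiable_chart x₀).mdifferentiableAt (hz x hx))
      (hΨd x hx)]
    rfl
  have hWx : ∀ x ∈ N, W x = mfderiv (𝓡 4) 𝓘(ℝ, E4) c (Ψ x)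
      (𝓣.timeOrientation.vectorField (Ψ x)) := fun x hx ↦ 𝓣.chartTime_eq_mfderiv (hz x hx)
  have hαx : ∀ x ∈ N, α x = 𝓣.metric.val (Ψ x) (mfderiv 𝓘(ℝ, E4) (𝓡 4) Ψ x V)
      (mfderiv 𝓘(ℝ, E4) (𝓡 4) Ψ x V) := by
    intro x hx
    show 𝓣.metricInCoords c.symm (c (Ψ x)) (Vc x) (Vc x) = _
    rw [hVcx x hx, 𝓣.metricInCoords_chartAt_symm_apply_mfderiv (hz x hx)]
  have hβx : ∀ x ∈ N, β x = 𝓣.metric.val (Ψ x) (𝓣.timeOrientation.vectorField (Ψ x))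
      (mfderiv 𝓘(ℝ, E4) (𝓡 4) Ψ x V) := by
    intro x hx
    show 𝓣.metricInCoords c.symm (c (Ψ x)) (W x) (Vc x) = _
    rw [hVcx x hx, hWx x hx, 𝓣.metricInCoords_chartAt_symm_apply_mfderiv (hz x hx)]
  have hγx : ∀ x ∈ N, γ x = 𝓣.metric.val (Ψ x) (𝓣.timeOrientation.vectorField (Ψ x))
      (𝓣.timeOrientation.vectorField (Ψ x)) := by
    intro x hx
    show 𝓣.metricInCoords c.symm (c (Ψ x)) (W x) (W x) = _
    rw [hWx x hx, 𝓣.metricInCoords_chartAt_symm_apply_mfderiv (hz x hx)]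
  have hαneg : ∀ x ∈ N, α x < 0 := fun x hx ↦ by rw [hαx x hx]; exact htl x hx
  have hβneg : ∀ x ∈ N, β x < 0 := fun x hx ↦ by rw [hβx x hx]; exact (hfut x hx).2
  have hγneg : ∀ x ∈ N, γ x < 0 := fun x hx ↦ by
    rw [hγx x hx]; exact 𝓣.timeOrientation.isTimelike (Ψ x)
  rcases N.eq_empty_or_nonempty with hNe | hNne
  · exact Eventually.of_forall fun n x hx ↦ by simp [hNe] at hx
  -- margins
  obtain ⟨μ, hμ, hαμ, hβμ, hγμ⟩ : ∃ μ : ℝ, 0 < μ ∧ (∀ x ∈ N, α x ≤ -μ) ∧ (∀ x ∈ N, β x ≤ -μ) ∧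
      ∀ x ∈ N, γ x ≤ -μ := by
    let Θ : E4 → ℝ := fun x ↦ max (α x) (max (β x) (γ x))
    have hΘc : ContinuousOn Θ N := hαc.sup (hβc.sup hγc)
    obtain ⟨x₁, hx₁, hmax⟩ := hN.exists_isMaxOn hNne hΘc
    have hΘneg : Θ x₁ < 0 := max_lt (hαneg x₁ hx₁) (max_lt (hβneg x₁ hx₁) (hγneg x₁ hx₁))
    refine ⟨-Θ x₁, by linarith, fun x hx ↦ ?_, fun x hx ↦ ?_, fun x hx ↦ ?_⟩
    · have h := hmax hx; simp only [neg_neg]; exact (le_max_left _ _).trans h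
    · have h := hmax hx; simp only [neg_neg]
      exact ((le_max_left _ _).trans (le_max_right _ _)).trans h
    · have h := hmax hx; simp only [neg_neg]
      exact ((le_max_right _ _).trans (le_max_right _ _)).trans h
  obtain ⟨B, hVB, hWB⟩ : ∃ B : ℝ, (∀ x ∈ N, ‖Vc x‖ ≤ B) ∧ ∀ x ∈ N, ‖W x‖ ≤ B := by
    obtain ⟨B₁, hB₁⟩ := hN.exists_bound_of_continuousOn hVcc
    obtain ⟨B₂, hB₂⟩ := hN.exists_bound_of_continuousOn hWc
    exact ⟨max B₁ B₂, fun x hx ↦ (hB₁ x hx).trans (le_max_left _ _),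
      fun x hx ↦ (hB₂ x hx).trans (le_max_right _ _)⟩
  set ε : ℝ := μ / (B ^ 2 + 1) with hε
  have hεpos : 0 < ε := div_pos hμ (by positivity)
  have hFN : IsCompact (Ψ '' N) := hN.image_of_continuousOn (hΨ.continuousOn.mono fun x hx ↦ (hNO hx).1)
  have hK' : IsCompact (c '' (Ψ '' N)) :=
    hFN.image_of_continuousOn (c.continuousOn.mono (by rintro _ ⟨x, hx, rfl⟩; exact hz x hx))
  have hK't : c '' (Ψ '' N) ⊆ c.target := by
    rintro _ ⟨_, ⟨x, hx, rfl⟩, rfl⟩; exact c.map_source (hz x hx)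
  have hE1 := D.eventually_subset_U hFN
  have hE2 : ∀ᶠ n in atTop, supCkENorm (c '' (Ψ '' N)) k (D.coordDeviation n x₀) <
      ENNReal.ofReal ε :=
    (tendsto_order.1 (D.tendsto_supCkENorm_coordDeviation x₀ hK' hK't)).2 _
      (ENNReal.ofReal_pos.2 hεpos)
  filter_upwards [hE1, hE2] with n hn1 hn2 x hx
  set z := Ψ x with hzdef
  have hzs : z ∈ c.source := hz x hx
  have hzU : z ∈ D.U n := hn1 (mem_image_of_mem _ hx)
  have hG : MDifferentiableAt (𝓡 4) (𝓡 4) (D.embed n) z :=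
    ((D.contMDiffOn_embed n z hzU).contMDiffAt ((D.U n).isOpen.mem_nhds hzU)).mdifferentiableAt
      (by simp)
  set uu : TangentSpace (𝓡 4) z := mfderiv 𝓘(ℝ, E4) (𝓡 4) Ψ x V with huudef
  set T' : TangentSpace (𝓡 4) z := 𝓣.timeOrientation.vectorField z with hT'def
  have hdev : ‖chartDeviation (𝓢ₙ (D.sub n)) (D.embed n) x₀ (c z)‖ < ε := by
    have hmem : c z ∈ c '' (Ψ '' N) := mem_image_of_mem _ (mem_image_of_mem _ hx)
    have hfin : supCkENorm (c '' (Ψ '' N)) k (D.coordDeviation n x₀) ≠ ⊤ :=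
      (hn2.trans ENNReal.ofReal_lt_top).ne
    have h0 := norm_iteratedFDeriv_le_toReal_supCkENorm (Nat.zero_le k) hmem
      (D.coordDeviation n x₀) hfin
    rw [norm_iteratedFDeriv_zero] at h0
    exact h0.trans_lt (ENNReal.toReal_lt_of_lt_ofReal hn2)
  have hd0 : 0 ≤ ‖chartDeviation (𝓢ₙ (D.sub n)) (D.embed n) x₀ (c z)‖ :=
    ContinuousLinearMap.opNorm_nonneg _
  have hVeq : Vc x = mfderiv (𝓡 4) 𝓘(ℝ, E4) c z uu := hVcx x hx
  have hWeq : W x = mfderiv (𝓡 4) 𝓘(ℝ, E4) c z T' := hWx x hx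
  have huu := 𝓣.abs_val_mfderiv_sub_val_le hzs hG uu uu hVeq hVeq
  have hTu := 𝓣.abs_val_mfderiv_sub_val_le hzs hG T' uu hWeq hVeq
  have hTT := 𝓣.abs_val_mfderiv_sub_val_le hzs hG T' T' hWeq hWeq
  have buu := mul_mul_lt_of_lt_div hd0 (norm_nonneg _) (norm_nonneg _) hμ (hVB x hx) (hVB x hx) hdev
  have bTu := mul_mul_lt_of_lt_div hd0 (norm_nonneg _) (norm_nonneg _) hμ (hWB x hx) (hVB x hx) hdev
  have bTT := mul_mul_lt_of_lt_div hd0 (norm_nonneg _) (norm_nonneg _) hμ (hWB x hx) (hWB x hx) hdev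
  have eα : 𝓣.metric.val z uu uu = α x := (hαx x hx).symm
  have eβ : 𝓣.metric.val z T' uu = β x := (hβx x hx).symm
  have eγ : 𝓣.metric.val z T' T' = γ x := (hγx x hx).symm
  rw [eα] at huu; rw [eβ] at hTu; rw [eγ] at hTT
  have h1 : (𝓢ₙ (D.sub n)).metric.val (D.embed n z) (mfderiv (𝓡 4) (𝓡 4) (D.embed n) z uu)
      (mfderiv (𝓡 4) (𝓡 4) (D.embed n) z uu) < 0 := by
    have := (abs_sub_lt_iff.1 (huu.trans_lt buu)).1; linarith [hαμ x hx]
  have h2 : (𝓢ₙ (D.sub n)).metric.val (D.embed n z) (mfderiv (𝓡 4) (𝓡 4) (D.embed n) z T')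
      (mfderiv (𝓡 4) (𝓡 4) (D.embed n) z uu) < 0 := by
    have := (abs_sub_lt_iff.1 (hTu.trans_lt bTu)).1; linarith [hβμ x hx]
  have h3 : (𝓢ₙ (D.sub n)).metric.val (D.embed n z) (mfderiv (𝓡 4) (𝓡 4) (D.embed n) z T')
      (mfderiv (𝓡 4) (𝓡 4) (D.embed n) z T') < 0 := by
    have := (abs_sub_lt_iff.1 (hTT.trans_lt bTT)).1; linarith [hγμ x hx]
  have hTfut := D.isFutureDirected_mfderiv_embed n z hzU
  have h1' : (𝓢ₙ (D.sub n)).metric.IsTimelike (mfderiv (𝓡 4) (𝓡 4) (D.embed n) z uu) := h1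
  have h3' : (𝓢ₙ (D.sub n)).metric.IsTimelike (mfderiv (𝓡 4) (𝓡 4) (D.embed n) z T') := h3
  have hres : (𝓢ₙ (D.sub n)).timeOrientation.IsFutureDirected
      (mfderiv (𝓡 4) (𝓡 4) (D.embed n) z uu) :=
    (𝓢ₙ (D.sub n)).timeOrientation.isFutureDirected_of_val_lt_zero hTfut h3' h1'.isCausal h2
  rw [mfderiv_comp x hG (hΨd x hx)]
  exact hres

/-- **Pushed charts keep their time orientation along a pointed `Cᵏ_loc` convergence.** For
`D : (𝓢ₙ, pₙ) ⇀ (𝓣, t)` with comparison maps `φₙ`, `Ψ : E4 → 𝓣` of class `C^∞` on an open `O`,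
`K ⊆ O` compact and a coordinate vector `V` with `dΨ_x(V)` future-directed and TIMELIKE for all
`x ∈ K`: for all large `n`, `d(φₙ ∘ Ψ)_x(V)` is future-directed in `𝓢ₙ` for every `x ∈ K` (the
orientation clause of pushed window charts; O'Neill 1983, Ch. 5, p. 145). [cite: Petersen2006, Ch. 10 §3.2] -/
theorem eventually_isFutureDirected_mfderiv_comp_chart (D : LocalSubconvergence 𝓢ₙ pₙ 𝓣 t k)
    {Ψ : E4 → 𝓣.carrier} {O : Set E4} (hO : IsOpen O) (hΨ : ContMDiffOn 𝓘(ℝ, E4) (𝓡 4) ∞ Ψ O)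
    {K : Set E4} (hK : IsCompact K) (hKO : K ⊆ O) (V : E4)
    (hfut : ∀ x ∈ K, 𝓣.timeOrientation.IsFutureDirected (mfderiv 𝓘(ℝ, E4) (𝓡 4) Ψ x V))
    (htl : ∀ x ∈ K, 𝓣.metric.IsTimelike (mfderiv 𝓘(ℝ, E4) (𝓡 4) Ψ x V)) :
    ∀ᶠ n in atTop, ∀ x ∈ K, (𝓢ₙ (D.sub n)).timeOrientation.IsFutureDirected
      (mfderiv 𝓘(ℝ, E4) (𝓡 4) (D.embed n ∘ Ψ) x V) := by
  classical
  set Oc : 𝓣.carrier → Set E4 := fun x₀ ↦ O ∩ Ψ ⁻¹' (chartAt E4 x₀).source with hOc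
  have hOco : ∀ x₀, IsOpen (Oc x₀) := fun x₀ ↦
    hΨ.continuousOn.isOpen_inter_preimage hO (chartAt E4 x₀).open_source
  have hcov : K ⊆ ⋃ x₀, Oc x₀ := fun x hx ↦ mem_iUnion.2 ⟨Ψ x, hKO hx, mem_chart_source E4 _⟩
  obtain ⟨S, ε, hSO, hKS⟩ := exists_finset_closedBall_pieces_of_isCompact hK Oc hOco hcov
  have hpiece : ∀ y ∈ S, ∀ᶠ n in atTop, ∀ x ∈ K ∩ closedBall y (ε y),
      (𝓢ₙ (D.sub n)).timeOrientation.IsFutureDirected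
        (mfderiv 𝓘(ℝ, E4) (𝓡 4) (D.embed n ∘ Ψ) x V) := by
    intro y hy
    obtain ⟨x₀, hNO⟩ := hSO y hy
    exact D.eventually_isFutureDirected_mfderiv_comp_chart_of_piece hO hΨ x₀
      (hK.inter_right isClosed_closedBall) hNO V (fun x hx ↦ hfut x hx.1) fun x hx ↦ htl x hx.1
  filter_upwards [(eventually_all_finset S).2 hpiece] with n hn x hx
  obtain ⟨y, hy, hxy⟩ := mem_iUnion₂.1 (hKS hx)
  exact hn y hy x hxy

end LocalSubconvergence

/-- **One sign on a connected set.** For `Ψ : E4 → 𝓣` of class `C^∞` on an open `O`, a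
preconnected `S ⊆ O` and a coordinate vector `V` with `dΨ_x(V)` CAUSAL for every `x ∈ S`: if
`dΨ_x(V)` is future-directed at ONE point of `S`, it is future-directed at every point of `S` — a
causal vector is never orthogonal to the orienting field (`val_ne_zero_of_isTimelike_of_isCausal`),
so the continuous function `x ↦ g(T, dΨ_x V)` does not vanish on `S` and keeps its sign
(O'Neill 1983, Ch. 5, Lemma 5.26 ff.). This is how the orientation clause of a window chart is
obtained on a connected sub-window from timelikeness (small deviation) and the orientation at the
anchor. [cite: ONeill1983, Ch. 5, Lemma 5.26 ff., p. 145] -/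
theorem isFutureDirected_mfderiv_of_isPreconnected {Ψ : E4 → 𝓣.carrier} {O : Set E4}
    (hO : IsOpen O) (hΨ : ContMDiffOn 𝓘(ℝ, E4) (𝓡 4) ∞ Ψ O) {S : Set E4}
    (hS : IsPreconnected S) (hSO : S ⊆ O) (V : E4)
    (hc : ∀ x ∈ S, 𝓣.metric.IsCausal (mfderiv 𝓘(ℝ, E4) (𝓡 4) Ψ x V)) {x₁ : E4} (hx₁ : x₁ ∈ S)
    (h₁ : 𝓣.timeOrientation.IsFutureDirected (mfderiv 𝓘(ℝ, E4) (𝓡 4) Ψ x₁ V)) :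
    ∀ x ∈ S, 𝓣.timeOrientation.IsFutureDirected (mfderiv 𝓘(ℝ, E4) (𝓡 4) Ψ x V) := by
  -- the sign function `β x = g(T(Ψ x), dΨ_x V)`
  let β : E4 → ℝ := fun x ↦ 𝓣.metric.val (Ψ x) (𝓣.timeOrientation.vectorField (Ψ x))
    (mfderiv 𝓘(ℝ, E4) (𝓡 4) Ψ x V)
  have hΨd : ∀ x ∈ O, MDifferentiableAt 𝓘(ℝ, E4) (𝓡 4) Ψ x := fun x hx ↦
    ((hΨ x hx).contMDiffAt (hO.mem_nhds hx)).mdifferentiableAt (by simp)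
  -- `β` is continuous on `O`: locally it is a scalar product of chart coordinates
  have hβc : ContinuousOn β O := by
    refine hO.continuousOn_iff.2 fun {a} ha ↦ ?_
    set c := chartAt E4 (Ψ a) with hc
    set O' : Set E4 := O ∩ Ψ ⁻¹' c.source with hO'
    have hO'o : IsOpen O' := hΨ.continuousOn.isOpen_inter_preimage hO c.open_source
    have haO' : a ∈ O' := ⟨ha, mem_chart_source E4 (Ψ a)⟩
    let θ : E4 → E4 := c ∘ Ψ
    let Vc : E4 → E4 := fun x ↦ fderiv ℝ θ x V
    let W : E4 → E4 := fun x ↦ 𝓣.timeOrientation.chartTime (Ψ a) (Ψ x)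
    let m : E4 → E4 →L[ℝ] E4 →L[ℝ] ℝ := fun x ↦ 𝓣.metricInCoords c.symm (c (Ψ x))
    have hθs : ContDiffOn ℝ ∞ θ O' := by
      rw [← contMDiffOn_iff_contDiffOn]
      exact (contMDiffOn_chart (x := Ψ a)).comp (hΨ.mono inter_subset_left) fun x hx ↦ hx.2
    have hVcc : ContinuousOn Vc O' :=
      (hθs.continuousOn_fderiv_of_isOpen hO'o (by exact_mod_cast le_top)).clm_apply
        continuousOn_const
    have hWc : ContinuousOn W O' :=
      (𝓣.timeOrientation.contMDiffOn_chartTime (by exact_mod_cast le_top) (Ψ a)).continuousOn.comp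
        (hΨ.continuousOn.mono inter_subset_left) fun _ hx ↦ hx.2
    have hmc : ContinuousOn m O' :=
      (𝓣.contDiffOn_metricInCoords_chartAt_symm (Ψ a)).continuousOn.comp
        (c.continuousOn.comp (hΨ.continuousOn.mono inter_subset_left) fun _ hx ↦ hx.2)
        fun _ hx ↦ c.map_source hx.2
    have hcont : ContinuousOn (fun x ↦ m x (W x) (Vc x)) O' := (hmc.clm_apply hWc).clm_apply hVcc
    have heq : EqOn β (fun x ↦ m x (W x) (Vc x)) O' := by
      intro x hx
      have hz : Ψ x ∈ c.source := hx.2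
      have hVcx : Vc x = mfderiv (𝓡 4) 𝓘(ℝ, E4) c (Ψ x) (mfderiv 𝓘(ℝ, E4) (𝓡 4) Ψ x V) := by
        show fderiv ℝ (c ∘ Ψ) x V = _
        rw [← mfderiv_eq_fderiv, mfderiv_comp x
          ((mdifferentiable_chart (Ψ a)).mdifferentiableAt hz) (hΨd x hx.1)]
        rfl
      have hWx : W x = mfderiv (𝓡 4) 𝓘(ℝ, E4) c (Ψ x) (𝓣.timeOrientation.vectorField (Ψ x)) :=
        𝓣.chartTime_eq_mfderiv hz
      show _ = 𝓣.metricInCoords c.symm (c (Ψ x)) (W x) (Vc x)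
      rw [hVcx, hWx, 𝓣.metricInCoords_chartAt_symm_apply_mfderiv hz]
    exact ((hcont.congr heq).continuousWithinAt haO').continuousAt (hO'o.mem_nhds haO')
  -- `β` does not vanish on `S` and is negative at `x₁`
  have hne : ∀ x ∈ S, β x ≠ 0 := fun x hx ↦
    𝓣.metric.val_ne_zero_of_isTimelike_of_isCausal (𝓣.timeOrientation.isTimelike (Ψ x)) (hc x hx)
  have hneg₁ : β x₁ < 0 := h₁.2
  intro x hx
  refine ⟨hc x hx, ?_⟩
  show β x < 0
  rcases lt_or_gt_of_ne (hne x hx) with h | h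
  · exact h
  · exfalso
    have hI := hS.intermediate_value hx₁ hx (hβc.mono hSO)
    obtain ⟨y, hy, hy0⟩ := hI ⟨hneg₁.le, h.le⟩
    exact hne y hy hy0

namespace LocalSubconvergence

/-- **Pushed charts keep their orientation on a connected compact set, from ONE point.** For
`D : (𝓢ₙ, pₙ) ⇀ (𝓣, t)`, `Ψ : E4 → 𝓣` of class `C^∞` on an open `O`, `K ⊆ O` compact and
preconnected, and `V` with `dΨ_x(V)` TIMELIKE for all `x ∈ K` and future-directed at one point
`x₁ ∈ K`: for all large `n`, `d(φₙ ∘ Ψ)_x(V)` is future-directed in `𝓢ₙ` for every `x ∈ K`. [cite: Petersen2006, Ch. 10 §3.2] -/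
theorem eventually_isFutureDirected_mfderiv_comp_chart_of_isPreconnected
    (D : LocalSubconvergence 𝓢ₙ pₙ 𝓣 t k) {Ψ : E4 → 𝓣.carrier} {O : Set E4} (hO : IsOpen O)
    (hΨ : ContMDiffOn 𝓘(ℝ, E4) (𝓡 4) ∞ Ψ O) {K : Set E4} (hK : IsCompact K)
    (hKc : IsPreconnected K) (hKO : K ⊆ O) (V : E4)
    (htl : ∀ x ∈ K, 𝓣.metric.IsTimelike (mfderiv 𝓘(ℝ, E4) (𝓡 4) Ψ x V)) {x₁ : E4} (hx₁ : x₁ ∈ K)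
    (h₁ : 𝓣.timeOrientation.IsFutureDirected (mfderiv 𝓘(ℝ, E4) (𝓡 4) Ψ x₁ V)) :
    ∀ᶠ n in atTop, ∀ x ∈ K, (𝓢ₙ (D.sub n)).timeOrientation.IsFutureDirected
      (mfderiv 𝓘(ℝ, E4) (𝓡 4) (D.embed n ∘ Ψ) x V) :=
  D.eventually_isFutureDirected_mfderiv_comp_chart hO hΨ hK hKO V
    (isFutureDirected_mfderiv_of_isPreconnected hO hΨ hKc hKO V
      (fun x hx ↦ (htl x hx).isCausal) hx₁ h₁) htl

end LocalSubconvergence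

end Spacetime

end Literature.Geometry.Lorentzian
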